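import Literature.Probability.RandomPlanarGeometry.SAWStripTMStrands
import HarnessLib

/-!
# Strand families: the `merge` primitive and its specification (soundness, part 2)

Topic `Literature/Probability/RandomPlanarGeometry` (soundness of `SAWStripTM.lean`, part 2;
continues `SAWStripTMStrands.lean`). The only operation the enriched transfer matrix performs on
its strand family is `merge S x y`: the strand with end `x` and the (different) strand with end
`y` are joined through the new edge `x—y`. `merge_spec` records its effect on well-formedness,
`cells`, `pairs` and `endPairs`. ("Extend a strand by a fresh cell" and "start a new strand" are
`merge` after `WF.add_singleton`.)

## References

* D. E. Knuth, *The Art of Computer Programming*, Vol. 4A (2011), §7.1.4, `SIMPATH`.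
-/

namespace Literature.Probability.RandomPlanarGeometry.SAW

namespace StripTM

variable {A : XCell → XCell → Prop}

/-- **Merge** the strand ending at `x` with the strand ending at `y` through the edge `x—y`.
[cite: Jensen2004SAWLowerBounds, §2.1] -/
def merge (S : List (List XCell)) (x y : XCell) : List (List XCell) :=
  match S.find? (isEnd x), S.find? (isEnd y) with
  | some π₁, some π₂ =>
      (S.filter fun π => !isEnd x π && !isEnd y π) ++ [orientTo π₁ x ++ (orientTo π₂ y).reverse]
  | _, _ => S

/-- In a well-formed family, `find? (isEnd x)` returns THE strand with end `x`. [folklore] -/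
theorem WF.find?_isEnd {S : List (List XCell)} (h : WF A S) {π : List XCell} (hπ : π ∈ S) {x : XCell}
    (hx : isEnd x π = true) : S.find? (isEnd x) = some π := by
  cases hf : S.find? (isEnd x) with
  | none => rw [List.find?_eq_none] at hf; exact absurd hx (by simpa using hf π hπ)
  | some π' =>
    have h1 : π' ∈ S := List.mem_of_find?_eq_some hf
    have h2 : isEnd x π' = true := List.find?_some hf
    rw [h.eq_of_mem h1 hπ (mem_of_isEnd h2) (mem_of_isEnd hx)]

/-- `orientTo` preserves `Nodup`. [folklore] -/
theorem nodup_orientTo {π : List XCell} (h : π.Nodup) (x : XCell) : (orientTo π x).Nodup := by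
  rcases orientTo_eq_or π x with e | e
  · rw [e]; exact h
  · rw [e]; exact List.nodup_reverse.2 h

/-- `orientTo` preserves chains for a symmetric adjacency. [folklore] -/
theorem isChain_orientTo (hA : ∀ a b, A a b → A b a) {π : List XCell} (h : π.IsChain A) (x : XCell) :
    (orientTo π x).IsChain A := by
  rcases orientTo_eq_or π x with e | e
  · rw [e]; exact h
  · rw [e]; exact List.isChain_reverse.2 (h.imp fun a b hab => hA a b hab)

/-- Reversal preserves chains for a symmetric adjacency. [folklore] -/
theorem isChain_reverse' (hA : ∀ a b, A a b → A b a) {π : List XCell} (h : π.IsChain A) :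
    π.reverse.IsChain A :=
  List.isChain_reverse.2 (h.imp fun a b hab => hA a b hab)

/-- Consecutive pairs of `orientTo`. [folklore] -/
theorem mem_cpairs_orientTo {π : List XCell} {x : XCell} {p : Sym2 XCell} :
    p ∈ cpairs (orientTo π x) ↔ p ∈ cpairs π := by
  rcases orientTo_eq_or π x with e | e <;> rw [e]; exact mem_cpairs_reverse

/-- End pairs of `orientTo`. [folklore] -/
theorem mem_epairs_orientTo {π : List XCell} {x : XCell} {a b : XCell} :
    (a, b) ∈ epairs (orientTo π x) ↔ (a, b) ∈ epairs π := by
  rcases orientTo_eq_or π x with e | e <;> rw [e]; exact mem_epairs_reverse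

/-- The ends of a strand oriented to end at `x` are `x` and its head. [folklore] -/
theorem isEnd_iff_of_orientTo {π : List XCell} {x bx z : XCell} (hx : isEnd x π = true)
    (hb : (orientTo π x).head? = some bx) : isEnd z π = true ↔ z = bx ∨ z = x := by
  have e : isEnd z π = isEnd z (orientTo π x) := by
    rcases orientTo_eq_or π x with e | e <;> rw [e]; rw [isEnd_reverse]
  rw [e, isEnd_iff, hb, getLast?_orientTo hx]
  simp only [Option.some.injEq]
  constructor
  · rintro (h | h); exact Or.inl h.symm; exact Or.inr h.symm
  · rintro (rfl | rfl); exact Or.inl rfl; exact Or.inr rfl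

/-- **Specification of `merge`.** Let `S` be well formed for a symmetric adjacency, `x` an end of
`π₁ ∈ S`, `y` an end of a different `π₂ ∈ S`, `A x y`, and `x` (resp. `y`) real unless its strand
is a singleton. Then `merge S x y` is well formed with the same cells, its edges are those of `S`
plus `s(x, y)`, and its end pairs are those of `S` not involving the four ends of `π₁, π₂`, plus
the two orientations of (far end of `x`, far end of `y`). [cite: Jensen2004SAWLowerBounds, §2.1] -/
theorem merge_spec {S : List (List XCell)} (hW : WF A S) (hA : ∀ a b, A a b → A b a)
    {π₁ π₂ : List XCell} (h₁ : π₁ ∈ S) (h₂ : π₂ ∈ S) (hne : π₁ ≠ π₂) {x y : XCell}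
    (hx : isEnd x π₁ = true) (hy : isEnd y π₂ = true) (hxy : A x y)
    (hxr : x.IsReal ∨ π₁ = [x]) (hyr : y.IsReal ∨ π₂ = [y]) :
    ∃ bx by_ : XCell, (x, bx) ∈ endPairs S ∧ (y, by_) ∈ endPairs S ∧
      WF A (merge S x y) ∧ cells (merge S x y) = cells S ∧
      pairs (merge S x y) = insert s(x, y) (pairs S) ∧
      ∀ a b, (a, b) ∈ endPairs (merge S x y) ↔
        ((a, b) ∈ endPairs S ∧ a ≠ x ∧ a ≠ bx ∧ a ≠ y ∧ a ≠ by_) ∨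
          (a = bx ∧ b = by_) ∨ (a = by_ ∧ b = bx) := by
  -- the two oriented pieces and the new strand
  set o₁ := orientTo π₁ x with ho₁
  set o₂ := orientTo π₂ y with ho₂
  set ν := o₁ ++ o₂.reverse with hν
  have hπ₁ne : π₁ ≠ [] := hW.ne_nil π₁ h₁
  have hπ₂ne : π₂ ≠ [] := hW.ne_nil π₂ h₂
  have ho₁ne : o₁ ≠ [] := by
    rcases orientTo_eq_or π₁ x with e | e <;> rw [ho₁, e] <;> simp [hπ₁ne]
  have ho₂ne : o₂ ≠ [] := by
    rcases orientTo_eq_or π₂ y with e | e <;> rw [ho₂, e] <;> simp [hπ₂ne]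
  set bx := o₁.head ho₁ne with hbx
  set by_ := o₂.head ho₂ne with hby
  have ho₁h : o₁.head? = some bx := List.head?_eq_some_head ho₁ne
  have ho₂h : o₂.head? = some by_ := List.head?_eq_some_head ho₂ne
  have ho₁l : o₁.getLast? = some x := getLast?_orientTo hx
  have ho₂l : o₂.getLast? = some y := getLast?_orientTo hy
  -- unfold `merge`
  have hm : merge S x y = (S.filter fun π => !isEnd x π && !isEnd y π) ++ [ν] := by
    rw [merge, hW.find?_isEnd h₁ hx, hW.find?_isEnd h₂ hy]
  -- disjointness of the two strands
  have hdisj12 : ∀ z ∈ π₁, z ∉ π₂ := fun z hz hz' => hne (hW.eq_of_mem h₁ h₂ hz hz')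
  -- which strands survive the filter
  have hfil : ∀ π, π ∈ (S.filter fun π => !isEnd x π && !isEnd y π) ↔ π ∈ S ∧ π ≠ π₁ ∧ π ≠ π₂ := by
    intro π
    rw [List.mem_filter]
    constructor
    · rintro ⟨hπ, hb⟩
      refine ⟨hπ, ?_, ?_⟩
      · rintro rfl; rw [hx] at hb; simp at hb
      · rintro rfl; rw [hy] at hb; simp at hb
    · rintro ⟨hπ, hn1, hn2⟩
      refine ⟨hπ, ?_⟩
      have e1 : isEnd x π = false := by
        rw [Bool.eq_false_iff]; intro h
        exact hn1 (hW.eq_of_mem hπ h₁ (mem_of_isEnd h) (mem_of_isEnd hx))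
      have e2 : isEnd y π = false := by
        rw [Bool.eq_false_iff]; intro h
        exact hn2 (hW.eq_of_mem hπ h₂ (mem_of_isEnd h) (mem_of_isEnd hy))
      simp [e1, e2]
  -- members of ν
  have hmemν : ∀ z, z ∈ ν ↔ z ∈ π₁ ∨ z ∈ π₂ := fun z => by
    rw [hν, List.mem_append, List.mem_reverse, ho₁, ho₂, mem_orientTo, mem_orientTo]
  -- ends of π₁ / π₂
  have hend1 : ∀ z, isEnd z π₁ = true ↔ z = bx ∨ z = x := fun z => isEnd_iff_of_orientTo hx ho₁h
  have hend2 : ∀ z, isEnd z π₂ = true ↔ z = by_ ∨ z = y := fun z => isEnd_iff_of_orientTo hy ho₂h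
  have hbx1 : bx ∈ π₁ := by rw [← mem_orientTo (x := x), ← ho₁]; exact List.head_mem ho₁ne
  have hby2 : by_ ∈ π₂ := by rw [← mem_orientTo (x := y), ← ho₂]; exact List.head_mem ho₂ne
  have hx1 : x ∈ π₁ := mem_of_isEnd hx
  have hy2 : y ∈ π₂ := mem_of_isEnd hy
  -- the end pairs (x, bx), (y, by) of S
  have hxbx : (x, bx) ∈ endPairs S := by
    refine mem_endPairs.2 ⟨π₁, h₁, ?_⟩
    rw [← mem_epairs_orientTo (x := x), ← ho₁, mem_epairs]
    exact Or.inr ⟨ho₁h, ho₁l⟩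
  have hyby : (y, by_) ∈ endPairs S := by
    refine mem_endPairs.2 ⟨π₂, h₂, ?_⟩
    rw [← mem_epairs_orientTo (x := y), ← ho₂, mem_epairs]
    exact Or.inr ⟨ho₂h, ho₂l⟩
  -- head / last of ν
  have hνh : ν.head? = some bx := by rw [hν, List.head?_append, ho₁h]; rfl
  have hνl : ν.getLast? = some by_ := by
    rw [hν, List.getLast?_append, List.getLast?_reverse, ho₂h]; rfl
  refine ⟨bx, by_, hxbx, hyby, ?_, ?_, ?_, ?_⟩
  · -- well-formedness
    rw [hm]
    refine ⟨?_, ?_, ?_, ?_, ?_⟩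
    · intro π hπ
      rw [List.mem_append, List.mem_singleton] at hπ
      rcases hπ with hπ | rfl
      · exact hW.ne_nil π ((hfil π).1 hπ).1
      · rw [hν]; simp [ho₁ne]
    · intro π hπ
      rw [List.mem_append, List.mem_singleton] at hπ
      rcases hπ with hπ | rfl
      · exact hW.nodup π ((hfil π).1 hπ).1
      · rw [hν, List.nodup_append]
        refine ⟨nodup_orientTo (hW.nodup π₁ h₁) x, List.nodup_reverse.2 (nodup_orientTo (hW.nodup π₂ h₂) y), ?_⟩
        intro z hz z' hz' e
        subst e
        rw [ho₁, mem_orientTo] at hz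
        rw [List.mem_reverse, ho₂, mem_orientTo] at hz'
        exact hdisj12 z hz hz'
    · intro π hπ
      rw [List.mem_append, List.mem_singleton] at hπ
      rcases hπ with hπ | rfl
      · exact hW.chain π ((hfil π).1 hπ).1
      · rw [hν]
        refine List.IsChain.append (isChain_orientTo hA (hW.chain π₁ h₁) x)
          (isChain_reverse' hA (isChain_orientTo hA (hW.chain π₂ h₂) y)) ?_
        intro a ha b hb
        rw [ho₁l] at ha
        rw [List.head?_reverse, ho₂l] at hb
        simp only [Option.mem_def, Option.some.injEq] at ha hb
        subst ha; subst hb; exact hxy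
    · rw [List.pairwise_append]
      refine ⟨hW.disj.sublist List.filter_sublist, List.pairwise_singleton _ _, ?_⟩
      intro π hπ π' hπ' z hz hz'
      rw [List.mem_singleton] at hπ'
      subst hπ'
      obtain ⟨hπS, hn1, hn2⟩ := (hfil π).1 hπ
      rcases (hmemν z).1 hz' with h | h
      · exact hn1 (hW.eq_of_mem hπS h₁ hz h)
      · exact hn2 (hW.eq_of_mem hπS h₂ hz h)
    · intro π hπ z hz hze
      rw [List.mem_append, List.mem_singleton] at hπ
      rcases hπ with hπ | rfl
      · exact hW.virt π ((hfil π).1 hπ).1 z hz hze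
      · -- interior vertices of ν are interior in π₁ or π₂, or equal to x or y
        have hzν : isEnd z ν = false := hze
        have hnot : z ≠ bx ∧ z ≠ by_ := by
          constructor
          · rintro rfl; rw [Bool.eq_false_iff] at hzν; exact hzν (isEnd_iff.2 (Or.inl hνh))
          · rintro rfl; rw [Bool.eq_false_iff] at hzν; exact hzν (isEnd_iff.2 (Or.inr hνl))
        rcases (hmemν z).1 hz with hz1 | hz2
        · by_cases he : isEnd z π₁ = true
          · rcases (hend1 z).1 he with rfl | rfl
            · exact absurd rfl hnot.1
            · rcases hxr with hr | hs
              · exact hr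
              · -- π₁ = [x]: then bx = x, contradiction
                exfalso; apply hnot.1
                have : o₁ = [z] := by rw [ho₁, hs]; simp [orientTo]
                simp [hbx, this]
          · exact hW.virt π₁ h₁ z hz1 (by simpa using he)
        · by_cases he : isEnd z π₂ = true
          · rcases (hend2 z).1 he with rfl | rfl
            · exact absurd rfl hnot.2
            · rcases hyr with hr | hs
              · exact hr
              · exfalso; apply hnot.2
                have : o₂ = [z] := by rw [ho₂, hs]; simp [orientTo]
                simp [hby, this]
          · exact hW.virt π₂ h₂ z hz2 (by simpa using he)
  · -- cells
    rw [hm]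
    ext z
    rw [mem_cells, mem_cells]
    constructor
    · rintro ⟨π, hπ, hz⟩
      rw [List.mem_append, List.mem_singleton] at hπ
      rcases hπ with hπ | rfl
      · exact ⟨π, ((hfil π).1 hπ).1, hz⟩
      · rcases (hmemν z).1 hz with h | h; exact ⟨π₁, h₁, h⟩; exact ⟨π₂, h₂, h⟩
    · rintro ⟨π, hπ, hz⟩
      by_cases hn : π ≠ π₁ ∧ π ≠ π₂
      · exact ⟨π, List.mem_append_left _ ((hfil π).2 ⟨hπ, hn.1, hn.2⟩), hz⟩
      · refine ⟨ν, List.mem_append_right _ (List.mem_singleton_self _), (hmemν z).2 ?_⟩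
        rw [not_and_or, not_not, not_not] at hn
        rcases hn with rfl | rfl; exact Or.inl hz; exact Or.inr hz
  · -- pairs
    rw [hm]
    have hcp : cpairs ν = cpairs o₁ ++ s(x, y) :: cpairs o₂.reverse := by
      rw [hν]; exact cpairs_append ho₁l (by rw [List.head?_reverse, ho₂l])
    ext p
    rw [mem_pairs, Finset.mem_insert, mem_pairs]
    constructor
    · rintro ⟨π, hπ, hp⟩
      rw [List.mem_append, List.mem_singleton] at hπ
      rcases hπ with hπ | rfl
      · exact Or.inr ⟨π, ((hfil π).1 hπ).1, hp⟩
      · rw [hcp, List.mem_append, List.mem_cons] at hp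
        rcases hp with hp | rfl | hp
        · rw [ho₁, mem_cpairs_orientTo] at hp; exact Or.inr ⟨π₁, h₁, hp⟩
        · exact Or.inl rfl
        · rw [mem_cpairs_reverse, ho₂, mem_cpairs_orientTo] at hp; exact Or.inr ⟨π₂, h₂, hp⟩
    · rintro (rfl | ⟨π, hπ, hp⟩)
      · exact ⟨ν, List.mem_append_right _ (List.mem_singleton_self _), by rw [hcp]; simp⟩
      · by_cases hn : π ≠ π₁ ∧ π ≠ π₂
        · exact ⟨π, List.mem_append_left _ ((hfil π).2 ⟨hπ, hn.1, hn.2⟩), hp⟩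
        · refine ⟨ν, List.mem_append_right _ (List.mem_singleton_self _), ?_⟩
          rw [hcp, List.mem_append, List.mem_cons]
          rw [not_and_or, not_not, not_not] at hn
          rcases hn with rfl | rfl
          · left; rwa [ho₁, mem_cpairs_orientTo]
          · right; right; rwa [mem_cpairs_reverse, ho₂, mem_cpairs_orientTo]
  · -- end pairs
    intro a b
    rw [hm, mem_endPairs]
    have hνep : ∀ a b, (a, b) ∈ epairs ν ↔ (a = bx ∧ b = by_) ∨ (a = by_ ∧ b = bx) := by
      intro a b; rw [mem_epairs, hνh, hνl]; simp only [Option.some.injEq]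
      constructor
      · rintro (⟨h1, h2⟩ | ⟨h1, h2⟩); exact Or.inl ⟨h1.symm, h2.symm⟩; exact Or.inr ⟨h2.symm, h1.symm⟩
      · rintro (⟨rfl, rfl⟩ | ⟨rfl, rfl⟩); exact Or.inl ⟨rfl, rfl⟩; exact Or.inr ⟨rfl, rfl⟩
    constructor
    · rintro ⟨π, hπ, hp⟩
      rw [List.mem_append, List.mem_singleton] at hπ
      rcases hπ with hπ | rfl
      · obtain ⟨hπS, hn1, hn2⟩ := (hfil π).1 hπ
        left
        have ha : a ∈ π := mem_of_isEnd (isEnd_of_mem_epairs hp)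
        refine ⟨mem_endPairs.2 ⟨π, hπS, hp⟩, ?_, ?_, ?_, ?_⟩
        · rintro rfl; exact hn1 (hW.eq_of_mem hπS h₁ ha hx1)
        · rintro rfl; exact hn1 (hW.eq_of_mem hπS h₁ ha hbx1)
        · rintro rfl; exact hn2 (hW.eq_of_mem hπS h₂ ha hy2)
        · rintro rfl; exact hn2 (hW.eq_of_mem hπS h₂ ha hby2)
      · right; exact (hνep a b).1 hp
    · rintro (⟨hab, h1, h2, h3, h4⟩ | h)
      · obtain ⟨π, hπS, hp⟩ := mem_endPairs.1 hab
        have hea := isEnd_of_mem_epairs hp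
        refine ⟨π, List.mem_append_left _ ((hfil π).2 ⟨hπS, ?_, ?_⟩), hp⟩
        · rintro rfl; rcases (hend1 a).1 hea with rfl | rfl; exact h2 rfl; exact h1 rfl
        · rintro rfl; rcases (hend2 a).1 hea with rfl | rfl; exact h4 rfl; exact h3 rfl
      · exact ⟨ν, List.mem_append_right _ (List.mem_singleton_self _), (hνep a b).2 h⟩

/-- `merge` unfolded in a well-formed family. [folklore] -/
theorem WF.merge_eq {S : List (List XCell)} (hW : WF A S) {π₁ π₂ : List XCell} (h₁ : π₁ ∈ S) (h₂ : π₂ ∈ S)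
    {x y : XCell} (hx : isEnd x π₁ = true) (hy : isEnd y π₂ = true) :
    merge S x y = (S.filter fun π => !isEnd x π && !isEnd y π) ++ [orientTo π₁ x ++ (orientTo π₂ y).reverse] := by
  rw [merge, hW.find?_isEnd h₁ hx, hW.find?_isEnd h₂ hy]

/-- The strands surviving a merge. [folklore] -/
theorem WF.mem_filter_merge {S : List (List XCell)} (hW : WF A S) {π₁ π₂ : List XCell} (h₁ : π₁ ∈ S)
    (h₂ : π₂ ∈ S) {x y : XCell} (hx : isEnd x π₁ = true) (hy : isEnd y π₂ = true) (π : List XCell) :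
    π ∈ (S.filter fun π => !isEnd x π && !isEnd y π) ↔ π ∈ S ∧ π ≠ π₁ ∧ π ≠ π₂ := by
  rw [List.mem_filter]
  constructor
  · rintro ⟨hπ, hb⟩
    refine ⟨hπ, ?_, ?_⟩
    · rintro rfl; rw [hx] at hb; simp at hb
    · rintro rfl; rw [hy] at hb; simp at hb
  · rintro ⟨hπ, hn1, hn2⟩
    refine ⟨hπ, ?_⟩
    have e1 : isEnd x π = false := by
      rw [Bool.eq_false_iff]; intro h
      exact hn1 (hW.eq_of_mem hπ h₁ (mem_of_isEnd h) (mem_of_isEnd hx))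
    have e2 : isEnd y π = false := by
      rw [Bool.eq_false_iff]; intro h
      exact hn2 (hW.eq_of_mem hπ h₂ (mem_of_isEnd h) (mem_of_isEnd hy))
    simp [e1, e2]

/-- Length of `orientTo`. [folklore] -/
@[simp] theorem length_orientTo (π : List XCell) (x : XCell) : (orientTo π x).length = π.length := by
  rcases orientTo_eq_or π x with e | e <;> rw [e]; rw [List.length_reverse]

/-- Strands after a merge: the survivors, or the merged strand of length `|π₁| + |π₂|`. [folklore] -/
theorem WF.mem_merge {S : List (List XCell)} (hW : WF A S) {π₁ π₂ : List XCell} (h₁ : π₁ ∈ S)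
    (h₂ : π₂ ∈ S) {x y : XCell} (hx : isEnd x π₁ = true) (hy : isEnd y π₂ = true) {π : List XCell}
    (hπ : π ∈ merge S x y) : (π ∈ S ∧ π ≠ π₁ ∧ π ≠ π₂) ∨ π.length = π₁.length + π₂.length := by
  rw [hW.merge_eq h₁ h₂ hx hy, List.mem_append, List.mem_singleton] at hπ
  rcases hπ with hπ | rfl
  · exact Or.inl ((hW.mem_filter_merge h₁ h₂ hx hy π).1 hπ)
  · right; simp


end StripTM

end Literature.Probability.RandomPlanarGeometry.SAW
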